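import Summits.CriticalPhenomena.SAWScalingLimit.Theorems.SAWDevelopingMapObservableToSLECanonicalTransferInsensitivityB
import Summits.CriticalPhenomena.SAWScalingLimit.Theorems.SAWDevelopingMapObservableToSLECanonicalTransferBoundaryExitFloor
import HarnessLib

/-!
# Crux `SAWDevelopingMap.ObservableToSLE` (stmt-CriticalPhenomena-10472), line
`floor-ratio-restriction-bootstrap`, stub `stub_canonicalTransfer`: REDUCTION of the stub to the
named inputs (HA) hull approximation and (CI) canonical insensitivity / (BA) boundary avoidance

Landing target:
`Summits/CriticalPhenomena/SAWScalingLimit/Theorems/SAWDevelopingMapObservableToSLECanonicalTransferReduction.lean`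
(`--supports stmt-CriticalPhenomena-10472`).  `discretisation_of_hypotheses` : the discretisation
input of `canonicalTransfer_ofDiscretisation` from the cocycle, (HA) and (CI) ((M1) =
`discretisation_core`, (M2'b) = `insensitivity_of_hullApprox`, (M2'a) = (CI));
`canonicalTransfer_of_hypotheses` : **the registered statement of `stub_canonicalTransfer`, verbatim,
from (HA) and (CI)**; `canonicalInsensitivityHyp_of_boundaryAvoidanceHyp`,
`canonicalTransfer_of_boundaryAvoidance` : the same from (HA) and floor boundary avoidance (BA)
(`canonicalInsensitivity_of_boundaryAvoidance_floor`); `stub_canonicalTransfer_reduction` (registered).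
(HA): every hull subdomain `D'` of `D` is approximated from outside by hull subdomains `D'' ⊇ D'`
swallowing a metric collar of `D'` with `Φ'_{A''}(0)^{5/8} ≤ (1 + ε) Φ'_A(0)^{5/8}`.  (CI): in a
floor domain with canonical floor endpoints the canonical critical SAW stays with probability `→ 1`
inside the inner family (component of the bulk vertex in the `25δ`-deep vertices) plus its
endpoints.  (BA): it avoids the `η`-collar of `∂D ∖ (B(a, r) ∪ B(b, r))` with probability `≥ 1 - ε`.
-/

noncomputable section

open scoped Topology BigOperators NNReal ENNReal
open Filter Set Metric MeasureTheory
open Literature.Probability.LatticeModels (HexVertex hexGraph hexCenter Site)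
open Literature.Probability.RandomPlanarGeometry
open Literature.Probability.RandomPlanarGeometry.SAW
open Literature.Probability.Percolation (PathIn)
open UpperHalfPlane (upperHalfPlaneSet)

namespace Summit.CriticalPhenomena.SAWScalingLimit.Theorems.ObservableToSLE.FloorRatio


/-- **Registered sub-goal `stub_canonicalTransfer_reduction`** (stmt-CriticalPhenomena-10472): the
floor-matching clauses determine the floor mid-edge under a canonical endpoint. [folklore] -/
theorem stub_canonicalTransfer_reduction :
    ∀ (a : HexVertex) (σ : Sym2 HexVertex),
    (a.2 = 0 → σ = s(a, ((a.1 - Pi.single 1 1, (1 : Fin 2)) : HexVertex))) →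
    (a.2 = 1 → σ = s((((a.1 + Pi.single 1 1, (0 : Fin 2))) : HexVertex), a)) →
    σ = s(a, if a.2 = 0 then ((a.1 - Pi.single 1 1, 1) : HexVertex) else (a.1 + Pi.single 1 1, 0)) := by
  intro a σ h0 h1
  by_cases hc : a.2 = 0
  · rw [if_pos hc]; exact h0 hc
  · rw [if_neg hc, h1 (Fin.eq_one_of_ne_zero _ hc)]; exact Sym2.eq_swap

/-- **The discretisation input from (HA) and (CI).**  Under the admissible restriction limit, the
discretisation input (M1) + (M2'a) + (M2'b) of `canonicalTransfer_ofDiscretisation` holds for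
every floor domain, hull subdomain and canonical endpoints PROVIDED (HA) every hull subdomain can be
approximated from outside by hull subdomains swallowing a metric collar with restriction derivative
numbers converging from above (a continuum fact: Carathéodory kernel continuity of `A ↦ Φ'_A(0)`
for shrinking smooth hulls), and (CI) the canonical critical SAW of a floor domain stays, with
probability `→ 1`, inside the inner family (component of the bulk vertex in the `25δ`-deep
vertices, exact floor rows) together with its endpoints (canonical insensitivity from above;
expected from the cocycle through a floor super-domain; it follows from boundary avoidance,
`canonicalInsensitivity_of_boundaryAvoidance_floor`).  (M1) is `discretisation_core`, (M2'b) is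
`insensitivity_of_hullApprox`. [cite: LawlerSchrammWerner2004SAW, §3.4 ("SAW satisfies restriction")] -/
theorem discretisation_of_hypotheses :
    (∀ (D D' : DobrushinDomain) (ρ : ℝ) (φ : ConformalEquiv upperHalfPlaneSet D.carrier)
    (Φ : ConformalEquiv (upperHalfPlaneSet \ φ.pullbackHull D') upperHalfPlaneSet) (d : ℝ)
    (Λ Λ' : ℝ → Finset HexVertex) (m : ℝ → ℤ) (a b : ℝ → Sym2 HexVertex),
    (0 < ρ ∧ (D.pt 1).im = (D.pt 0).im ∧ D.carrier ⊆ {z : ℂ | (D.pt 0).im < z.im} ∧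
    D.carrier ∩ ball (D.pt 0) ρ = {z : ℂ | (D.pt 0).im < z.im} ∩ ball (D.pt 0) ρ ∧
    D.carrier ∩ ball (D.pt 1) ρ = {z : ℂ | (D.pt 1).im < z.im} ∩ ball (D.pt 1) ρ) → D.IsHullSubdomain D' → D.IsChordalUniformizing φ →
    IsRestrictionMap (φ.pullbackHull D') Φ → HasRestrictionDeriv (φ.pullbackHull D') Φ d →
    (∀ᶠ δ : ℝ in 𝓝[>] 0,
    Λ' δ ⊆ Λ δ ∧ hexDomainSimplyConnected (Λ δ) ∧ hexDomainSimplyConnected (Λ' δ) ∧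
    (hexGraph.induce (↑(Λ δ) : Set HexVertex)).Preconnected ∧
    (hexGraph.induce (↑(Λ' δ) : Set HexVertex)).Preconnected ∧
    a δ ∈ hexDomainBoundary (Λ δ) ∧ b δ ∈ hexDomainBoundary (Λ δ) ∧
    a δ ∈ hexDomainBoundary (Λ' δ) ∧ b δ ∈ hexDomainBoundary (Λ' δ) ∧
    Nonempty (HexMidEdgeSAW (Λ' δ) (a δ) (b δ)) ∧
    (∀ v ∈ Λ δ, (δ : ℂ) * hexCenter v ∈ D.carrier ∧ m δ ≤ v.1 1) ∧
    (∀ v ∈ Λ' δ, (δ : ℂ) * hexCenter v ∈ D'.carrier) ∧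
    (∀ v : HexVertex, (δ : ℂ) * hexCenter v ∈ ball (D.pt 0) ρ ∪ ball (D.pt 1) ρ →
    ((v ∈ Λ δ ↔ m δ ≤ v.1 1) ∧ (v ∈ Λ' δ ↔ m δ ≤ v.1 1)))) →
    (∀ K : Set ℂ, IsCompact K → K ⊆ D.carrier →
    ∀ᶠ δ : ℝ in 𝓝[>] 0, ∀ v : HexVertex, (δ : ℂ) * hexCenter v ∈ K → v ∈ Λ δ) →
    (∀ K : Set ℂ, IsCompact K → K ⊆ D'.carrier →
    ∀ᶠ δ : ℝ in 𝓝[>] 0, ∀ v : HexVertex, (δ : ℂ) * hexCenter v ∈ K → v ∈ Λ' δ) →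
    Tendsto (fun δ : ℝ => (δ : ℂ) * hexMidpoint (a δ)) (𝓝[>] 0) (𝓝 (D.pt 0)) →
    Tendsto (fun δ : ℝ => (δ : ℂ) * hexMidpoint (b δ)) (𝓝[>] 0) (𝓝 (D.pt 1)) →
    Tendsto (fun δ : ℝ => (∑ γ : HexMidEdgeSAW (Λ' δ) (a δ) (b δ), hexCriticalFugacity ^ γ.length) /
    (∑ γ : HexMidEdgeSAW (Λ δ) (a δ) (b δ), hexCriticalFugacity ^ γ.length)) (𝓝[>] 0)
    (𝓝 (d ^ ((5 : ℝ) / 8)))) →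
    -- (HA) hull approximation from outside of hull subdomains
    (∀ (D D' : DobrushinDomain), D.IsHullSubdomain D' →
      ∀ (φ : ConformalEquiv upperHalfPlaneSet D.carrier)
      (Φ : ConformalEquiv (upperHalfPlaneSet \ φ.pullbackHull D') upperHalfPlaneSet) (d : ℝ),
      D.IsChordalUniformizing φ → IsRestrictionMap (φ.pullbackHull D') Φ →
      HasRestrictionDeriv (φ.pullbackHull D') Φ d →
      ∀ ε : ℝ, 0 < ε → ∃ (D'' : DobrushinDomain)
        (Φ'' : ConformalEquiv (upperHalfPlaneSet \ φ.pullbackHull D'') upperHalfPlaneSet) (d'' η : ℝ),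
        D.IsHullSubdomain D'' ∧ D'.carrier ⊆ D''.carrier ∧ 0 < η ∧
        (∀ z ∈ D.carrier, Metric.infDist z D'.carrier ≤ η → z ∈ D''.carrier) ∧
        IsRestrictionMap (φ.pullbackHull D'') Φ'' ∧ HasRestrictionDeriv (φ.pullbackHull D'') Φ'' d'' ∧
        d'' ^ ((5 : ℝ) / 8) ≤ (1 + ε) * d ^ ((5 : ℝ) / 8)) →
    -- (CI) canonical insensitivity from above for the inner families
    (∀ (D : DobrushinDomain) (ρ ρ' : ℝ) (a b : ℝ → HexVertex) (Λ : ℝ → Finset HexVertex)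
      (m : ℝ → ℤ) (v₀ : ℝ → HexVertex),
      (0 < ρ ∧ (D.pt 1).im = (D.pt 0).im ∧ D.carrier ⊆ {z : ℂ | (D.pt 0).im < z.im} ∧
      D.carrier ∩ ball (D.pt 0) ρ = {z : ℂ | (D.pt 0).im < z.im} ∩ ball (D.pt 0) ρ ∧
      D.carrier ∩ ball (D.pt 1) ρ = {z : ℂ | (D.pt 1).im < z.im} ∩ ball (D.pt 1) ρ) →
      (IsEmbEndpointApprox hexGraph hexCenter D a b ∧ ∀ᶠ δ : ℝ in 𝓝[>] 0,
      (∃ u : HexVertex, hexGraph.Adj (a δ) u ∧ ((δ : ℂ) * hexCenter u).im ≤ (D.pt 0).im) ∧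
      (∃ u : HexVertex, hexGraph.Adj (b δ) u ∧ ((δ : ℂ) * hexCenter u).im ≤ (D.pt 1).im)) →
      0 < ρ' →
      (∀ δ : ℝ, 0 < δ → ((m δ : ℝ) - 2 / 3) * (δ * (Real.sqrt 3 / 2)) ≤ (D.pt 0).im ∧
        (D.pt 0).im < ((m δ : ℝ) + 1 / 3) * (δ * (Real.sqrt 3 / 2))) →
      ({z : ℂ | (D.pt 0).im < z.im} ∩ ball (D.pt 0) (16 * ρ') ⊆ D.carrier) →
      ({z : ℂ | (D.pt 0).im < z.im} ∩ ball (D.pt 1) (16 * ρ') ⊆ D.carrier) →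
      (∀ δ : ℝ, 0 < δ →
        dist ((δ : ℂ) * hexCenter (v₀ δ)) (D.pt 0 + ((4 * ρ' : ℝ) : ℂ) * Complex.I) ≤ δ) →
      (∀ᶠ δ : ℝ in 𝓝[>] 0, ∀ z : HexVertex, z ∈ Λ δ ↔ PathIn hexGraph
        {u : HexVertex | (δ : ℂ) * hexCenter u ∈ D.carrier ∧ m δ ≤ u.1 1 ∧
          closedBall ((δ : ℂ) * hexCenter u) (25 * δ) ∩ {z : ℂ | (D.pt 0).im < z.im} ⊆
            D.carrier ∪ ball (D.pt 0) (12 * ρ') ∪ ball (D.pt 1) (12 * ρ')} (v₀ δ) z) →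
      (∀ᶠ δ : ℝ in 𝓝[>] 0, ∀ v : HexVertex,
        (δ : ℂ) * hexCenter v ∈ ball (D.pt 0) ρ' ∪ ball (D.pt 1) ρ' → m δ ≤ v.1 1 → v ∈ Λ δ) →
      Tendsto (fun δ : ℝ => ((hexSAWLaw D.carrier δ (a δ) (b δ))
        {γ | ∀ v ∈ γ.walk.support, v ∈ Λ δ ∨ v = a δ ∨ v = b δ}).toReal) (𝓝[>] 0) (𝓝 1)) →
    -- the discretisation input of `canonicalTransfer_ofDiscretisation`
    ∀ (D D' : DobrushinDomain) (ρ : ℝ) (a b : ℝ → HexVertex),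
    (0 < ρ ∧ (D.pt 1).im = (D.pt 0).im ∧ D.carrier ⊆ {z : ℂ | (D.pt 0).im < z.im} ∧
    D.carrier ∩ ball (D.pt 0) ρ = {z : ℂ | (D.pt 0).im < z.im} ∩ ball (D.pt 0) ρ ∧
    D.carrier ∩ ball (D.pt 1) ρ = {z : ℂ | (D.pt 1).im < z.im} ∩ ball (D.pt 1) ρ) →
    D.IsHullSubdomain D' →
    (IsEmbEndpointApprox hexGraph hexCenter D a b ∧ ∀ᶠ δ : ℝ in 𝓝[>] 0,
    (∃ u : HexVertex, hexGraph.Adj (a δ) u ∧ ((δ : ℂ) * hexCenter u).im ≤ (D.pt 0).im) ∧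
    (∃ u : HexVertex, hexGraph.Adj (b δ) u ∧ ((δ : ℂ) * hexCenter u).im ≤ (D.pt 1).im)) →
    ∃ (ρ' : ℝ) (Λ Λ' Λ'' : ℝ → Finset HexVertex) (m : ℝ → ℤ) (σa σb : ℝ → Sym2 HexVertex),
    0 < ρ' ∧ ρ' ≤ ρ ∧
    (∀ᶠ δ : ℝ in 𝓝[>] 0,
    Λ' δ ⊆ Λ δ ∧ hexDomainSimplyConnected (Λ δ) ∧ hexDomainSimplyConnected (Λ' δ) ∧
    (hexGraph.induce (↑(Λ δ) : Set HexVertex)).Preconnected ∧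
    (hexGraph.induce (↑(Λ' δ) : Set HexVertex)).Preconnected ∧
    σa δ ∈ hexDomainBoundary (Λ δ) ∧ σb δ ∈ hexDomainBoundary (Λ δ) ∧
    σa δ ∈ hexDomainBoundary (Λ' δ) ∧ σb δ ∈ hexDomainBoundary (Λ' δ) ∧
    Nonempty (HexMidEdgeSAW (Λ' δ) (σa δ) (σb δ)) ∧
    (∀ v ∈ Λ δ, (δ : ℂ) * hexCenter v ∈ D.carrier ∧ m δ ≤ v.1 1) ∧
    (∀ v ∈ Λ' δ, (δ : ℂ) * hexCenter v ∈ D'.carrier) ∧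
    (∀ v : HexVertex, (δ : ℂ) * hexCenter v ∈ ball (D.pt 0) ρ' ∪ ball (D.pt 1) ρ' →
    ((v ∈ Λ δ ↔ m δ ≤ v.1 1) ∧ (v ∈ Λ' δ ↔ m δ ≤ v.1 1)))) ∧
    (∀ K : Set ℂ, IsCompact K → K ⊆ D.carrier →
    ∀ᶠ δ : ℝ in 𝓝[>] 0, ∀ v : HexVertex, (δ : ℂ) * hexCenter v ∈ K → v ∈ Λ δ) ∧
    (∀ K : Set ℂ, IsCompact K → K ⊆ D'.carrier →
    ∀ᶠ δ : ℝ in 𝓝[>] 0, ∀ v : HexVertex, (δ : ℂ) * hexCenter v ∈ K → v ∈ Λ' δ) ∧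
    Tendsto (fun δ : ℝ => (δ : ℂ) * hexMidpoint (σa δ)) (𝓝[>] 0) (𝓝 (D.pt 0)) ∧
    Tendsto (fun δ : ℝ => (δ : ℂ) * hexMidpoint (σb δ)) (𝓝[>] 0) (𝓝 (D.pt 1)) ∧
    (∀ᶠ δ : ℝ in 𝓝[>] 0,
    Λ' δ ⊆ Λ'' δ ∧ Λ'' δ ⊆ Λ δ ∧
    (∀ v ∈ Λ δ, ∀ w ∈ Λ δ, hexGraph.Adj v w → (hexDomainGraph D.carrier δ).Adj v w) ∧
    (∀ v ∈ Λ' δ, ∀ w ∈ Λ' δ, hexGraph.Adj v w →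
    (embMeshGraph hexGraph hexCenter D'.carrier δ).Adj v w) ∧
    (∀ v ∈ Λ'' δ, ∀ w ∈ Λ δ, (δ : ℂ) * hexCenter w ∈ D'.carrier →
    (embMeshGraph hexGraph hexCenter D'.carrier δ).Adj v w → w ∈ Λ'' δ) ∧
    ((a δ).2 = 0 → m δ = (a δ).1 1 ∧ σa δ = s(a δ, ((a δ).1 - Pi.single 1 1, (1 : Fin 2)))) ∧
    ((a δ).2 = 1 → m δ = (a δ).1 1 + 1 ∧
    σa δ = s((((a δ).1 + Pi.single 1 1, (0 : Fin 2)) : HexVertex), a δ)) ∧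
    ((b δ).2 = 0 → σb δ = s(b δ, ((b δ).1 - Pi.single 1 1, (1 : Fin 2)))) ∧
    ((b δ).2 = 1 → σb δ = s((((b δ).1 + Pi.single 1 1, (0 : Fin 2)) : HexVertex), b δ))) ∧
    Tendsto (fun δ : ℝ => ((hexSAWLaw D.carrier δ (a δ) (b δ))
    {γ | ∀ v ∈ γ.walk.support, v ∈ Λ δ ∨ v = a δ ∨ v = b δ}).toReal) (𝓝[>] 0) (𝓝 1) ∧
    Tendsto (fun δ : ℝ =>
    (∑ γ : HexMidEdgeSAW (Λ'' δ) (σa δ) (σb δ), hexCriticalFugacity ^ γ.length) /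
    (∑ γ : HexMidEdgeSAW (Λ' δ) (σa δ) (σb δ), hexCriticalFugacity ^ γ.length))
    (𝓝[>] 0) (𝓝 1)
 := by
  intro H HA CI D D' ρ a b hfl hD' hend
  obtain ⟨ρ', Λ, Λ', Λ'', m, σa, σb, hρ'0, hρ'ρ, hADM, hK, hK', hσa, hσb, hL, hm, hflD'0, hflD'1,
    v₀, hv₀, hΛ, hΛ', hΛ''⟩ := discretisation_core D D' ρ a b hfl hD' hend
  have hD'D : D'.carrier ⊆ D.carrier := hD'.carrier_subset
  have hrows : ∀ᶠ δ : ℝ in 𝓝[>] 0, ∀ v : HexVertex,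
      (δ : ℂ) * hexCenter v ∈ ball (D.pt 0) ρ' ∪ ball (D.pt 1) ρ' → m δ ≤ v.1 1 →
        v ∈ Λ δ ∧ v ∈ Λ' δ := by
    filter_upwards [hADM] with δ h v hv hvm
    obtain ⟨-, -, -, -, -, -, -, -, -, -, -, -, hrow⟩ := h
    exact ⟨((hrow v hv).1).2 hvm, ((hrow v hv).2).2 hvm⟩
  refine ⟨ρ', Λ, Λ', Λ'', m, σa, σb, hρ'0, hρ'ρ, hADM, hK, hK', hσa, hσb, hL,
    CI D ρ ρ' a b Λ m v₀ hfl hend hρ'0 hm (hflD'0.trans hD'D) (hflD'1.trans hD'D) hv₀ hΛ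
      (hrows.mono fun δ h v hv hvm => (h v hv hvm).1), ?_⟩
  have hσa' : ∀ᶠ δ : ℝ in 𝓝[>] 0, σa δ = s(a δ, if (a δ).2 = 0 then
      (((a δ).1 - Pi.single 1 1, 1) : HexVertex) else ((a δ).1 + Pi.single 1 1, 0)) := by
    filter_upwards [hL] with δ h
    obtain ⟨-, -, -, -, -, h0, h1, -, -⟩ := h
    exact stub_canonicalTransfer_reduction (a δ) (σa δ) (fun hc => (h0 hc).2) (fun hc => (h1 hc).2)
  have hσb' : ∀ᶠ δ : ℝ in 𝓝[>] 0, σb δ = s(b δ, if (b δ).2 = 0 then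
      (((b δ).1 - Pi.single 1 1, 1) : HexVertex) else ((b δ).1 + Pi.single 1 1, 0)) := by
    filter_upwards [hL] with δ h
    obtain ⟨-, -, -, -, -, -, -, h0, h1⟩ := h
    exact stub_canonicalTransfer_reduction (b δ) (σb δ) h0 h1
  refine insensitivity_of_hullApprox H D D' ρ ρ' a b Λ Λ' Λ'' m σa σb v₀ hfl hD' hend (HA D D' hD')
    hρ'0 hm hflD'0 hflD'1 hv₀ ?_ ?_ hΛ'' hrows hK hK' hσa' hσb'
  · filter_upwards [hADM, hΛ] with δ h1 h2
    exact ⟨h1.2.1, h1.2.2.2.1, h2⟩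
  · filter_upwards [hADM, hΛ'] with δ h1 h2
    exact ⟨h1.2.2.1, h1.2.2.2.2.1, h2⟩

/-- **`stub_canonicalTransfer` from (HA) and (CI)**: the registered statement of the stub
`stub_canonicalTransfer` (admissible restriction limit `→` floor restriction limit for the canonical
law), verbatim, from (HA) and (CI) (`canonicalTransfer_ofDiscretisation` with
`discretisation_of_hypotheses`). [cite: LawlerSchrammWerner2004SAW, §3.4 ("SAW satisfies restriction")] -/
theorem canonicalTransfer_of_hypotheses :
    (∀ (D D' : DobrushinDomain), D.IsHullSubdomain D' →
      ∀ (φ : ConformalEquiv upperHalfPlaneSet D.carrier)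
      (Φ : ConformalEquiv (upperHalfPlaneSet \ φ.pullbackHull D') upperHalfPlaneSet) (d : ℝ),
      D.IsChordalUniformizing φ → IsRestrictionMap (φ.pullbackHull D') Φ →
      HasRestrictionDeriv (φ.pullbackHull D') Φ d →
      ∀ ε : ℝ, 0 < ε → ∃ (D'' : DobrushinDomain)
        (Φ'' : ConformalEquiv (upperHalfPlaneSet \ φ.pullbackHull D'') upperHalfPlaneSet) (d'' η : ℝ),
        D.IsHullSubdomain D'' ∧ D'.carrier ⊆ D''.carrier ∧ 0 < η ∧
        (∀ z ∈ D.carrier, Metric.infDist z D'.carrier ≤ η → z ∈ D''.carrier) ∧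
        IsRestrictionMap (φ.pullbackHull D'') Φ'' ∧ HasRestrictionDeriv (φ.pullbackHull D'') Φ'' d'' ∧
        d'' ^ ((5 : ℝ) / 8) ≤ (1 + ε) * d ^ ((5 : ℝ) / 8)) →
    (∀ (D : DobrushinDomain) (ρ ρ' : ℝ) (a b : ℝ → HexVertex) (Λ : ℝ → Finset HexVertex)
      (m : ℝ → ℤ) (v₀ : ℝ → HexVertex),
      (0 < ρ ∧ (D.pt 1).im = (D.pt 0).im ∧ D.carrier ⊆ {z : ℂ | (D.pt 0).im < z.im} ∧
      D.carrier ∩ ball (D.pt 0) ρ = {z : ℂ | (D.pt 0).im < z.im} ∩ ball (D.pt 0) ρ ∧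
      D.carrier ∩ ball (D.pt 1) ρ = {z : ℂ | (D.pt 1).im < z.im} ∩ ball (D.pt 1) ρ) →
      (IsEmbEndpointApprox hexGraph hexCenter D a b ∧ ∀ᶠ δ : ℝ in 𝓝[>] 0,
      (∃ u : HexVertex, hexGraph.Adj (a δ) u ∧ ((δ : ℂ) * hexCenter u).im ≤ (D.pt 0).im) ∧
      (∃ u : HexVertex, hexGraph.Adj (b δ) u ∧ ((δ : ℂ) * hexCenter u).im ≤ (D.pt 1).im)) →
      0 < ρ' →
      (∀ δ : ℝ, 0 < δ → ((m δ : ℝ) - 2 / 3) * (δ * (Real.sqrt 3 / 2)) ≤ (D.pt 0).im ∧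
        (D.pt 0).im < ((m δ : ℝ) + 1 / 3) * (δ * (Real.sqrt 3 / 2))) →
      ({z : ℂ | (D.pt 0).im < z.im} ∩ ball (D.pt 0) (16 * ρ') ⊆ D.carrier) →
      ({z : ℂ | (D.pt 0).im < z.im} ∩ ball (D.pt 1) (16 * ρ') ⊆ D.carrier) →
      (∀ δ : ℝ, 0 < δ →
        dist ((δ : ℂ) * hexCenter (v₀ δ)) (D.pt 0 + ((4 * ρ' : ℝ) : ℂ) * Complex.I) ≤ δ) →
      (∀ᶠ δ : ℝ in 𝓝[>] 0, ∀ z : HexVertex, z ∈ Λ δ ↔ PathIn hexGraph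
        {u : HexVertex | (δ : ℂ) * hexCenter u ∈ D.carrier ∧ m δ ≤ u.1 1 ∧
          closedBall ((δ : ℂ) * hexCenter u) (25 * δ) ∩ {z : ℂ | (D.pt 0).im < z.im} ⊆
            D.carrier ∪ ball (D.pt 0) (12 * ρ') ∪ ball (D.pt 1) (12 * ρ')} (v₀ δ) z) →
      (∀ᶠ δ : ℝ in 𝓝[>] 0, ∀ v : HexVertex,
        (δ : ℂ) * hexCenter v ∈ ball (D.pt 0) ρ' ∪ ball (D.pt 1) ρ' → m δ ≤ v.1 1 → v ∈ Λ δ) →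
      Tendsto (fun δ : ℝ => ((hexSAWLaw D.carrier δ (a δ) (b δ))
        {γ | ∀ v ∈ γ.walk.support, v ∈ Λ δ ∨ v = a δ ∨ v = b δ}).toReal) (𝓝[>] 0) (𝓝 1)) →
    (
    ∀ (D D' : DobrushinDomain) (ρ : ℝ) (φ : ConformalEquiv upperHalfPlaneSet D.carrier)
    (Φ : ConformalEquiv (upperHalfPlaneSet \ φ.pullbackHull D') upperHalfPlaneSet) (d : ℝ)
    (Λ Λ' : ℝ → Finset HexVertex) (m : ℝ → ℤ) (a b : ℝ → Sym2 HexVertex),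
    (0 < ρ ∧ (D.pt 1).im = (D.pt 0).im ∧ D.carrier ⊆ {z : ℂ | (D.pt 0).im < z.im} ∧
    D.carrier ∩ ball (D.pt 0) ρ = {z : ℂ | (D.pt 0).im < z.im} ∩ ball (D.pt 0) ρ ∧
    D.carrier ∩ ball (D.pt 1) ρ = {z : ℂ | (D.pt 1).im < z.im} ∩ ball (D.pt 1) ρ) → D.IsHullSubdomain D' → D.IsChordalUniformizing φ →
    IsRestrictionMap (φ.pullbackHull D') Φ → HasRestrictionDeriv (φ.pullbackHull D') Φ d →
    (∀ᶠ δ : ℝ in 𝓝[>] 0,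
    Λ' δ ⊆ Λ δ ∧ hexDomainSimplyConnected (Λ δ) ∧ hexDomainSimplyConnected (Λ' δ) ∧
    (hexGraph.induce (↑(Λ δ) : Set HexVertex)).Preconnected ∧
    (hexGraph.induce (↑(Λ' δ) : Set HexVertex)).Preconnected ∧
    a δ ∈ hexDomainBoundary (Λ δ) ∧ b δ ∈ hexDomainBoundary (Λ δ) ∧
    a δ ∈ hexDomainBoundary (Λ' δ) ∧ b δ ∈ hexDomainBoundary (Λ' δ) ∧
    Nonempty (HexMidEdgeSAW (Λ' δ) (a δ) (b δ)) ∧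
    (∀ v ∈ Λ δ, (δ : ℂ) * hexCenter v ∈ D.carrier ∧ m δ ≤ v.1 1) ∧
    (∀ v ∈ Λ' δ, (δ : ℂ) * hexCenter v ∈ D'.carrier) ∧
    (∀ v : HexVertex, (δ : ℂ) * hexCenter v ∈ ball (D.pt 0) ρ ∪ ball (D.pt 1) ρ →
    ((v ∈ Λ δ ↔ m δ ≤ v.1 1) ∧ (v ∈ Λ' δ ↔ m δ ≤ v.1 1)))) →
    (∀ K : Set ℂ, IsCompact K → K ⊆ D.carrier →
    ∀ᶠ δ : ℝ in 𝓝[>] 0, ∀ v : HexVertex, (δ : ℂ) * hexCenter v ∈ K → v ∈ Λ δ) →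
    (∀ K : Set ℂ, IsCompact K → K ⊆ D'.carrier →
    ∀ᶠ δ : ℝ in 𝓝[>] 0, ∀ v : HexVertex, (δ : ℂ) * hexCenter v ∈ K → v ∈ Λ' δ) →
    Tendsto (fun δ : ℝ => (δ : ℂ) * hexMidpoint (a δ)) (𝓝[>] 0) (𝓝 (D.pt 0)) →
    Tendsto (fun δ : ℝ => (δ : ℂ) * hexMidpoint (b δ)) (𝓝[>] 0) (𝓝 (D.pt 1)) →
    Tendsto (fun δ : ℝ => (∑ γ : HexMidEdgeSAW (Λ' δ) (a δ) (b δ), hexCriticalFugacity ^ γ.length) /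
    (∑ γ : HexMidEdgeSAW (Λ δ) (a δ) (b δ), hexCriticalFugacity ^ γ.length)) (𝓝[>] 0)
    (𝓝 (d ^ ((5 : ℝ) / 8)))) →
  ∀ (D D' : DobrushinDomain) (ρ : ℝ) (φ : ConformalEquiv upperHalfPlaneSet D.carrier)
  (Φ : ConformalEquiv (upperHalfPlaneSet \ φ.pullbackHull D') upperHalfPlaneSet) (d : ℝ)
  (a b : ℝ → HexVertex),
  (0 < ρ ∧ (D.pt 1).im = (D.pt 0).im ∧ D.carrier ⊆ {z : ℂ | (D.pt 0).im < z.im} ∧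
  D.carrier ∩ ball (D.pt 0) ρ = {z : ℂ | (D.pt 0).im < z.im} ∩ ball (D.pt 0) ρ ∧
  D.carrier ∩ ball (D.pt 1) ρ = {z : ℂ | (D.pt 1).im < z.im} ∩ ball (D.pt 1) ρ) → D.IsHullSubdomain D' → D.IsChordalUniformizing φ →
  IsRestrictionMap (φ.pullbackHull D') Φ → HasRestrictionDeriv (φ.pullbackHull D') Φ d →
  (IsEmbEndpointApprox hexGraph hexCenter D a b ∧ ∀ᶠ δ : ℝ in 𝓝[>] 0,
  (∃ u : HexVertex, hexGraph.Adj (a δ) u ∧ ((δ : ℂ) * hexCenter u).im ≤ (D.pt 0).im) ∧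
  (∃ u : HexVertex, hexGraph.Adj (b δ) u ∧ ((δ : ℂ) * hexCenter u).im ≤ (D.pt 1).im)) →
  Tendsto (fun δ : ℝ => ((hexSAWLaw D.carrier δ (a δ) (b δ))
  {γ | (∀ v ∈ γ.walk.support, v ∈ embMeshVertices hexCenter D'.carrier δ) ∧
  ∀ e ∈ γ.walk.darts,
  (embMeshGraph hexGraph hexCenter D'.carrier δ).Adj e.fst e.snd}).toReal)
  (𝓝[>] 0) (𝓝 (d ^ ((5 : ℝ) / 8))) :=
  fun HA CI hARL => canonicalTransfer_ofDiscretisation (fun H => discretisation_of_hypotheses H HA CI) hARL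

/-- **(CI) from floor boundary avoidance (BA)** (`canonicalInsensitivity_of_boundaryAvoidance_floor`). [folklore] -/
theorem canonicalInsensitivityHyp_of_boundaryAvoidanceHyp :
    (∀ (D : DobrushinDomain) (ρ : ℝ) (a b : ℝ → HexVertex) (r : ℝ),
      (0 < ρ ∧ (D.pt 1).im = (D.pt 0).im ∧ D.carrier ⊆ {z : ℂ | (D.pt 0).im < z.im} ∧
      D.carrier ∩ ball (D.pt 0) ρ = {z : ℂ | (D.pt 0).im < z.im} ∩ ball (D.pt 0) ρ ∧
      D.carrier ∩ ball (D.pt 1) ρ = {z : ℂ | (D.pt 1).im < z.im} ∩ ball (D.pt 1) ρ) →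
      (IsEmbEndpointApprox hexGraph hexCenter D a b ∧ ∀ᶠ δ : ℝ in 𝓝[>] 0,
      (∃ u : HexVertex, hexGraph.Adj (a δ) u ∧ ((δ : ℂ) * hexCenter u).im ≤ (D.pt 0).im) ∧
      (∃ u : HexVertex, hexGraph.Adj (b δ) u ∧ ((δ : ℂ) * hexCenter u).im ≤ (D.pt 1).im)) →
      0 < r → ∀ ε : ℝ, 0 < ε → ∃ η : ℝ, 0 < η ∧ ∀ᶠ δ : ℝ in 𝓝[>] 0,
        ((hexSAWLaw D.carrier δ (a δ) (b δ)) {γ | ∃ v ∈ γ.walk.support, v ≠ a δ ∧ v ≠ b δ ∧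
          Metric.infDist ((δ : ℂ) * hexCenter v)
            (frontier D.carrier \ (ball (D.pt 0) r ∪ ball (D.pt 1) r)) ≤ η}).toReal ≤ ε) →
    ∀ (D : DobrushinDomain) (ρ ρ' : ℝ) (a b : ℝ → HexVertex) (Λ : ℝ → Finset HexVertex)
      (m : ℝ → ℤ) (v₀ : ℝ → HexVertex),
      (0 < ρ ∧ (D.pt 1).im = (D.pt 0).im ∧ D.carrier ⊆ {z : ℂ | (D.pt 0).im < z.im} ∧
      D.carrier ∩ ball (D.pt 0) ρ = {z : ℂ | (D.pt 0).im < z.im} ∩ ball (D.pt 0) ρ ∧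
      D.carrier ∩ ball (D.pt 1) ρ = {z : ℂ | (D.pt 1).im < z.im} ∩ ball (D.pt 1) ρ) →
      (IsEmbEndpointApprox hexGraph hexCenter D a b ∧ ∀ᶠ δ : ℝ in 𝓝[>] 0,
      (∃ u : HexVertex, hexGraph.Adj (a δ) u ∧ ((δ : ℂ) * hexCenter u).im ≤ (D.pt 0).im) ∧
      (∃ u : HexVertex, hexGraph.Adj (b δ) u ∧ ((δ : ℂ) * hexCenter u).im ≤ (D.pt 1).im)) →
      0 < ρ' →
      (∀ δ : ℝ, 0 < δ → ((m δ : ℝ) - 2 / 3) * (δ * (Real.sqrt 3 / 2)) ≤ (D.pt 0).im ∧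
        (D.pt 0).im < ((m δ : ℝ) + 1 / 3) * (δ * (Real.sqrt 3 / 2))) →
      ({z : ℂ | (D.pt 0).im < z.im} ∩ ball (D.pt 0) (16 * ρ') ⊆ D.carrier) →
      ({z : ℂ | (D.pt 0).im < z.im} ∩ ball (D.pt 1) (16 * ρ') ⊆ D.carrier) →
      (∀ δ : ℝ, 0 < δ →
        dist ((δ : ℂ) * hexCenter (v₀ δ)) (D.pt 0 + ((4 * ρ' : ℝ) : ℂ) * Complex.I) ≤ δ) →
      (∀ᶠ δ : ℝ in 𝓝[>] 0, ∀ z : HexVertex, z ∈ Λ δ ↔ PathIn hexGraph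
        {u : HexVertex | (δ : ℂ) * hexCenter u ∈ D.carrier ∧ m δ ≤ u.1 1 ∧
          closedBall ((δ : ℂ) * hexCenter u) (25 * δ) ∩ {z : ℂ | (D.pt 0).im < z.im} ⊆
            D.carrier ∪ ball (D.pt 0) (12 * ρ') ∪ ball (D.pt 1) (12 * ρ')} (v₀ δ) z) →
      (∀ᶠ δ : ℝ in 𝓝[>] 0, ∀ v : HexVertex,
        (δ : ℂ) * hexCenter v ∈ ball (D.pt 0) ρ' ∪ ball (D.pt 1) ρ' → m δ ≤ v.1 1 → v ∈ Λ δ) →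
      Tendsto (fun δ : ℝ => ((hexSAWLaw D.carrier δ (a δ) (b δ))
        {γ | ∀ v ∈ γ.walk.support, v ∈ Λ δ ∨ v = a δ ∨ v = b δ}).toReal) (𝓝[>] 0) (𝓝 1)
 :=
  fun BA D ρ ρ' a b Λ m v₀ hfl hend hρ'0 hm _ _ _ hΛ hrows =>
    canonicalInsensitivity_of_boundaryAvoidance_floor hfl.2.2.1 hend.1 hρ'0 hm hΛ hrows
      (BA D ρ a b (11 * ρ') hfl hend (by positivity))

/-- **`stub_canonicalTransfer` from (HA) and floor boundary avoidance (BA).** [cite: LawlerSchrammWerner2004SAW, §3.4 ("SAW satisfies restriction")] -/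
theorem canonicalTransfer_of_boundaryAvoidance :
    (∀ (D D' : DobrushinDomain), D.IsHullSubdomain D' →
      ∀ (φ : ConformalEquiv upperHalfPlaneSet D.carrier)
      (Φ : ConformalEquiv (upperHalfPlaneSet \ φ.pullbackHull D') upperHalfPlaneSet) (d : ℝ),
      D.IsChordalUniformizing φ → IsRestrictionMap (φ.pullbackHull D') Φ →
      HasRestrictionDeriv (φ.pullbackHull D') Φ d →
      ∀ ε : ℝ, 0 < ε → ∃ (D'' : DobrushinDomain)
        (Φ'' : ConformalEquiv (upperHalfPlaneSet \ φ.pullbackHull D'') upperHalfPlaneSet) (d'' η : ℝ),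
        D.IsHullSubdomain D'' ∧ D'.carrier ⊆ D''.carrier ∧ 0 < η ∧
        (∀ z ∈ D.carrier, Metric.infDist z D'.carrier ≤ η → z ∈ D''.carrier) ∧
        IsRestrictionMap (φ.pullbackHull D'') Φ'' ∧ HasRestrictionDeriv (φ.pullbackHull D'') Φ'' d'' ∧
        d'' ^ ((5 : ℝ) / 8) ≤ (1 + ε) * d ^ ((5 : ℝ) / 8)) →
    (∀ (D : DobrushinDomain) (ρ : ℝ) (a b : ℝ → HexVertex) (r : ℝ),
      (0 < ρ ∧ (D.pt 1).im = (D.pt 0).im ∧ D.carrier ⊆ {z : ℂ | (D.pt 0).im < z.im} ∧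
      D.carrier ∩ ball (D.pt 0) ρ = {z : ℂ | (D.pt 0).im < z.im} ∩ ball (D.pt 0) ρ ∧
      D.carrier ∩ ball (D.pt 1) ρ = {z : ℂ | (D.pt 1).im < z.im} ∩ ball (D.pt 1) ρ) →
      (IsEmbEndpointApprox hexGraph hexCenter D a b ∧ ∀ᶠ δ : ℝ in 𝓝[>] 0,
      (∃ u : HexVertex, hexGraph.Adj (a δ) u ∧ ((δ : ℂ) * hexCenter u).im ≤ (D.pt 0).im) ∧
      (∃ u : HexVertex, hexGraph.Adj (b δ) u ∧ ((δ : ℂ) * hexCenter u).im ≤ (D.pt 1).im)) →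
      0 < r → ∀ ε : ℝ, 0 < ε → ∃ η : ℝ, 0 < η ∧ ∀ᶠ δ : ℝ in 𝓝[>] 0,
        ((hexSAWLaw D.carrier δ (a δ) (b δ)) {γ | ∃ v ∈ γ.walk.support, v ≠ a δ ∧ v ≠ b δ ∧
          Metric.infDist ((δ : ℂ) * hexCenter v)
            (frontier D.carrier \ (ball (D.pt 0) r ∪ ball (D.pt 1) r)) ≤ η}).toReal ≤ ε) →
    (
    ∀ (D D' : DobrushinDomain) (ρ : ℝ) (φ : ConformalEquiv upperHalfPlaneSet D.carrier)
    (Φ : ConformalEquiv (upperHalfPlaneSet \ φ.pullbackHull D') upperHalfPlaneSet) (d : ℝ)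
    (Λ Λ' : ℝ → Finset HexVertex) (m : ℝ → ℤ) (a b : ℝ → Sym2 HexVertex),
    (0 < ρ ∧ (D.pt 1).im = (D.pt 0).im ∧ D.carrier ⊆ {z : ℂ | (D.pt 0).im < z.im} ∧
    D.carrier ∩ ball (D.pt 0) ρ = {z : ℂ | (D.pt 0).im < z.im} ∩ ball (D.pt 0) ρ ∧
    D.carrier ∩ ball (D.pt 1) ρ = {z : ℂ | (D.pt 1).im < z.im} ∩ ball (D.pt 1) ρ) → D.IsHullSubdomain D' → D.IsChordalUniformizing φ →
    IsRestrictionMap (φ.pullbackHull D') Φ → HasRestrictionDeriv (φ.pullbackHull D') Φ d →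
    (∀ᶠ δ : ℝ in 𝓝[>] 0,
    Λ' δ ⊆ Λ δ ∧ hexDomainSimplyConnected (Λ δ) ∧ hexDomainSimplyConnected (Λ' δ) ∧
    (hexGraph.induce (↑(Λ δ) : Set HexVertex)).Preconnected ∧
    (hexGraph.induce (↑(Λ' δ) : Set HexVertex)).Preconnected ∧
    a δ ∈ hexDomainBoundary (Λ δ) ∧ b δ ∈ hexDomainBoundary (Λ δ) ∧
    a δ ∈ hexDomainBoundary (Λ' δ) ∧ b δ ∈ hexDomainBoundary (Λ' δ) ∧
    Nonempty (HexMidEdgeSAW (Λ' δ) (a δ) (b δ)) ∧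
    (∀ v ∈ Λ δ, (δ : ℂ) * hexCenter v ∈ D.carrier ∧ m δ ≤ v.1 1) ∧
    (∀ v ∈ Λ' δ, (δ : ℂ) * hexCenter v ∈ D'.carrier) ∧
    (∀ v : HexVertex, (δ : ℂ) * hexCenter v ∈ ball (D.pt 0) ρ ∪ ball (D.pt 1) ρ →
    ((v ∈ Λ δ ↔ m δ ≤ v.1 1) ∧ (v ∈ Λ' δ ↔ m δ ≤ v.1 1)))) →
    (∀ K : Set ℂ, IsCompact K → K ⊆ D.carrier →
    ∀ᶠ δ : ℝ in 𝓝[>] 0, ∀ v : HexVertex, (δ : ℂ) * hexCenter v ∈ K → v ∈ Λ δ) →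
    (∀ K : Set ℂ, IsCompact K → K ⊆ D'.carrier →
    ∀ᶠ δ : ℝ in 𝓝[>] 0, ∀ v : HexVertex, (δ : ℂ) * hexCenter v ∈ K → v ∈ Λ' δ) →
    Tendsto (fun δ : ℝ => (δ : ℂ) * hexMidpoint (a δ)) (𝓝[>] 0) (𝓝 (D.pt 0)) →
    Tendsto (fun δ : ℝ => (δ : ℂ) * hexMidpoint (b δ)) (𝓝[>] 0) (𝓝 (D.pt 1)) →
    Tendsto (fun δ : ℝ => (∑ γ : HexMidEdgeSAW (Λ' δ) (a δ) (b δ), hexCriticalFugacity ^ γ.length) /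
    (∑ γ : HexMidEdgeSAW (Λ δ) (a δ) (b δ), hexCriticalFugacity ^ γ.length)) (𝓝[>] 0)
    (𝓝 (d ^ ((5 : ℝ) / 8)))) →
  ∀ (D D' : DobrushinDomain) (ρ : ℝ) (φ : ConformalEquiv upperHalfPlaneSet D.carrier)
  (Φ : ConformalEquiv (upperHalfPlaneSet \ φ.pullbackHull D') upperHalfPlaneSet) (d : ℝ)
  (a b : ℝ → HexVertex),
  (0 < ρ ∧ (D.pt 1).im = (D.pt 0).im ∧ D.carrier ⊆ {z : ℂ | (D.pt 0).im < z.im} ∧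
  D.carrier ∩ ball (D.pt 0) ρ = {z : ℂ | (D.pt 0).im < z.im} ∩ ball (D.pt 0) ρ ∧
  D.carrier ∩ ball (D.pt 1) ρ = {z : ℂ | (D.pt 1).im < z.im} ∩ ball (D.pt 1) ρ) → D.IsHullSubdomain D' → D.IsChordalUniformizing φ →
  IsRestrictionMap (φ.pullbackHull D') Φ → HasRestrictionDeriv (φ.pullbackHull D') Φ d →
  (IsEmbEndpointApprox hexGraph hexCenter D a b ∧ ∀ᶠ δ : ℝ in 𝓝[>] 0,
  (∃ u : HexVertex, hexGraph.Adj (a δ) u ∧ ((δ : ℂ) * hexCenter u).im ≤ (D.pt 0).im) ∧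
  (∃ u : HexVertex, hexGraph.Adj (b δ) u ∧ ((δ : ℂ) * hexCenter u).im ≤ (D.pt 1).im)) →
  Tendsto (fun δ : ℝ => ((hexSAWLaw D.carrier δ (a δ) (b δ))
  {γ | (∀ v ∈ γ.walk.support, v ∈ embMeshVertices hexCenter D'.carrier δ) ∧
  ∀ e ∈ γ.walk.darts,
  (embMeshGraph hexGraph hexCenter D'.carrier δ).Adj e.fst e.snd}).toReal)
  (𝓝[>] 0) (𝓝 (d ^ ((5 : ℝ) / 8))) :=
  fun HA BA => canonicalTransfer_of_hypotheses HA (canonicalInsensitivityHyp_of_boundaryAvoidanceHyp BA)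

end Summit.CriticalPhenomena.SAWScalingLimit.Theorems.ObservableToSLE.FloorRatio

end
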